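import Mathlib.LinearAlgebra.Dual.Lemmas
import Mathlib.LinearAlgebra.FiniteDimensional.Basic
import Mathlib.LinearAlgebra.LinearIndependent.Lemmas
import Mathlib.Tactic.Module
import Literature.Computability.AlgebraicComplexity.MatrixMultiplicationExponent
import HarnessLib

/-!
# Kauers–Moosbauer flip graphs: completeness of flips (KM 2023, Lemma 5, Lemma 6, Thm. 7, Cor. 10)

Topic `Literature/Computability/AlgebraicComplexity`, tree coordinates for tensors
(`t : ι → κ → μ → K`, rank-one tensors `triad a b c = a ⊗ b ⊗ c` of
`MatrixMultiplicationExponent.lean`); companion of `FlipGraphMoves.lean` (flips and reductions are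
sound). Source: M. Kauers, J. Moosbauer, *Flip Graphs for Matrix Multiplication*, ISSAC 2023 =
arXiv:2212.01175 (KM), §3. Everything here is PROVED; no named facts.

**KM Thm. 7** (`kauersMoosbauer2023_thm7`). Let `A⁽ⁱ⁾ ≠ 0`, `B⁽ⁱ⁾ ≠ 0`, `Γ⁽ⁱ⁾ ≠ 0` (`i = 1..4`) with
`A⁽¹⁾⊗B⁽¹⁾⊗Γ⁽¹⁾ + A⁽²⁾⊗B⁽²⁾⊗Γ⁽²⁾ = A⁽³⁾⊗B⁽³⁾⊗Γ⁽³⁾ + A⁽⁴⁾⊗B⁽⁴⁾⊗Γ⁽⁴⁾`,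
`dim⟨B⁽¹⁾,B⁽²⁾⟩ = dim⟨Γ⁽¹⁾,Γ⁽²⁾⟩ = 2` and `{T⁽¹⁾, T⁽²⁾} ≠ {T⁽³⁾, T⁽⁴⁾}`. Then
(1) `dim⟨A⁽¹⁾,A⁽²⁾,A⁽³⁾,A⁽⁴⁾⟩ = 1`, (2) `⟨B⁽¹⁾,B⁽²⁾⟩ = ⟨B⁽³⁾,B⁽⁴⁾⟩`, (3) `⟨Γ⁽¹⁾,Γ⁽²⁾⟩ = ⟨Γ⁽³⁾,Γ⁽⁴⁾⟩`
— "if we want to replace two rank-one tensors nontrivially by two others, then they must agree in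
one of the factors and this factor cannot change; the spaces generated by the other factors must
stay the same" (KM, after Thm. 7). Over `K = ℤ₂` this is why flips are the only two-element moves
(KM Cor. 10; its content for the two replaced elements is `kauersMoosbauer2023_cor10` below, the
scheme-level wrapper — irreducible schemes differing in exactly two elements — is not formalised).
KM's two lemmas are also stated AS PRINTED: `kauersMoosbauer2023_lem5` (all three factor pairs of
`T⁽¹⁾, T⁽²⁾` independent ⇒ `{T⁽¹⁾,T⁽²⁾} = {T⁽³⁾,T⁽⁴⁾}`, derived here from Thm. 7 (1)) and
`kauersMoosbauer2023_lem6` (the matrix identity `B⁽¹⁾⊗Γ⁽¹⁾ + B⁽²⁾⊗Γ⁽²⁾ = B⁽³⁾⊗Γ⁽³⁾ + B⁽⁴⁾⊗Γ⁽⁴⁾`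
with `dim⟨B⁽¹⁾,B⁽²⁾⟩ = dim⟨Γ⁽¹⁾,Γ⁽²⁾⟩ = 2`, `Γ⁽³⁾ ≠ 0` ⇒ equal spans).

Proof. KM derive (1) from their Lemma 5 (uniqueness of `2+2` decompositions when all three factor
pairs are independent, proved there by "a straightforward computation" on `8` cubic equations) and
(2), (3) from Lemma 6. We follow the same architecture but replace the coordinate computation by
contractions with linear functionals (`Module.Dual`), which exist for independent pairs over a
field (`exists_dual_pair`): contracting the identity in two slots shows `A⁽¹⁾, A⁽²⁾ ∈ ⟨A⁽³⁾,A⁽⁴⁾⟩`;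
if `A⁽³⁾, A⁽⁴⁾` were independent, contracting the first slot with their dual functionals exhibits
`B⁽³⁾⊗Γ⁽³⁾` and `B⁽⁴⁾⊗Γ⁽⁴⁾` as rank-one members of the pencil `⟨B⁽¹⁾⊗Γ⁽¹⁾, B⁽²⁾⊗Γ⁽²⁾⟩`, whose only
rank-one members are the multiples of its two generators (`pencil_rankOne`) — forcing
`{T⁽³⁾,T⁽⁴⁾} = {T⁽¹⁾,T⁽²⁾}` or a zero `A`, contradiction; this is KM's Lemma 5 in contracted form.
With all `A⁽ⁱ⁾` on one line the identity contracts to KM's matrix identity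
`B⁽¹⁾⊗Γ⁽¹⁾ + B⁽²⁾⊗Γ⁽²⁾ = B⁽³⁾⊗Γ⁽³⁾ + B⁽⁴⁾⊗Γ⁽⁴⁾` (up to non-zero scalars) and Lemma 6 is again read
off by contracting with dual functionals (the reverse inclusions use that `B⁽³⁾,B⁽⁴⁾` and
`Γ⁽³⁾,Γ⁽⁴⁾` must themselves be independent, by the pencil lemma, in place of KM's dimension count).

Faithfulness: hypotheses as printed except that `B⁽¹⁾,B⁽²⁾,Γ⁽¹⁾,Γ⁽²⁾ ≠ 0` (implied by their
independence) and `B⁽⁴⁾,Γ⁽⁴⁾ ≠ 0` (not needed) are omitted; "`dim⟨B⁽¹⁾,B⁽²⁾⟩ = 2`" is rendered as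
`LinearIndependent K ![b₁, b₂]`; conclusion (1) is `Module.finrank K (span K {a₁, a₂, a₃, a₄}) = 1`
verbatim, and (2), (3) are equalities of spans verbatim. Vector spaces are the coordinate spaces
`ι → K`, `κ → K`, `μ → K` of the tree's tensor vocabulary (arbitrary index types, any field `K`).

## References

* M. Kauers, J. Moosbauer, *Flip Graphs for Matrix Multiplication*, ISSAC 2023, 381–388,
  doi:10.1145/3597066.3597120, arXiv:2212.01175: §3 Lemma 5, Lemma 6, Thm. 7, Cor. 10.
  [KauersMoosbauer2022FlipGraphs]
-/

namespace Literature.Computability.AlgebraicComplexity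

namespace FlipGraph

open Module Submodule

section Field

variable {K : Type*} [Field K]

/-! ## Dual functionals for an independent pair -/

section Dual

variable {V : Type*} [AddCommGroup V] [Module K V]

/-- For a linearly independent pair `v, w` in a vector space there is a linear functional with
`φ v = 1`, `φ w = 0` (dual basis of `⟨v, w⟩` extended to `V`). [folklore] -/
private theorem exists_dual_pair {v w : V} (h : LinearIndependent K ![v, w]) :
    ∃ φ : Module.Dual K V, φ v = 1 ∧ φ w = 0 := by
  have hv : v ∉ (K ∙ w) := by
    intro hmem
    obtain ⟨t, ht⟩ := Submodule.mem_span_singleton.mp hmem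
    have h10 := (LinearIndependent.pair_iff.mp h) 1 (-t)
      (by rw [one_smul, neg_smul, ht, add_neg_cancel])
    exact one_ne_zero h10.1
  obtain ⟨f, hfv, hfw⟩ := Submodule.exists_dual_map_eq_bot_of_notMem hv inferInstance
  have hw0 : f w = 0 := by
    have hw : f w ∈ (K ∙ w).map f :=
      Submodule.mem_map_of_mem (Submodule.mem_span_singleton_self w)
    rwa [hfw, Submodule.mem_bot] at hw
  exact ⟨(f v)⁻¹ • f, by simp [inv_mul_cancel₀ hfv], by simp [hw0]⟩

/-- The companion functional: `ψ v = 0`, `ψ w = 1`. [folklore] -/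
private theorem exists_dual_pair' {v w : V} (h : LinearIndependent K ![v, w]) :
    ∃ ψ : Module.Dual K V, ψ v = 0 ∧ ψ w = 1 := by
  obtain ⟨ψ, h1, h0⟩ := exists_dual_pair (LinearIndependent.pair_symm_iff.mp h)
  exact ⟨ψ, h0, h1⟩

end Dual

/-! ## Contractions of sums of two rank-one tensors -/

section Contract

variable {ι κ μ : Type*}

/-- Contracting the first slot of `a⊗b⊗c + a'⊗b'⊗c'` with a functional `φ`:
`φ(a)·(b⊗c) + φ(a')·(b'⊗c')`. [folklore] -/
private theorem contract₁_pair (φ : Module.Dual K (ι → K)) (a a' : ι → K) (b b' : κ → K)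
    (c c' : μ → K) :
    (fun y z => φ (fun x => (triad a b c + triad a' b' c') x y z)) =
      φ a • (fun y z => b y * c z) + φ a' • (fun y z => b' y * c' z) := by
  funext y z
  have hx : (fun x => (triad a b c + triad a' b' c') x y z) =
      (b y * c z) • a + (b' y * c' z) • a' := by
    funext x
    simp only [Pi.add_apply, Pi.smul_apply, triad_apply, smul_eq_mul]
    ring
  rw [hx, map_add, map_smul, map_smul]
  simp only [smul_eq_mul, Pi.add_apply, Pi.smul_apply]
  ring

/-- Contracting the second and third slots of `a⊗b⊗c + a'⊗b'⊗c'` with functionals `ψ`, `χ`: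
`ψ(b)χ(c)·a + ψ(b')χ(c')·a'`. [folklore] -/
private theorem contract₂₃_pair (ψ : Module.Dual K (κ → K)) (χ : Module.Dual K (μ → K))
    (a a' : ι → K) (b b' : κ → K) (c c' : μ → K) :
    (fun x => χ (fun z => ψ (fun y => (triad a b c + triad a' b' c') x y z))) =
      (ψ b * χ c) • a + (ψ b' * χ c') • a' := by
  funext x
  have hy : ∀ z, (fun y => (triad a b c + triad a' b' c') x y z) =
      (a x * c z) • b + (a' x * c' z) • b' := by
    intro z
    funext y
    simp only [Pi.add_apply, Pi.smul_apply, triad_apply, smul_eq_mul]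
    ring
  have hz : (fun z => ψ (fun y => (triad a b c + triad a' b' c') x y z)) =
      (a x * ψ b) • c + (a' x * ψ b') • c' := by
    funext z
    rw [hy z]
    simp only [map_add, map_smul, smul_eq_mul, Pi.add_apply, Pi.smul_apply]
    ring
  rw [hz]
  simp only [map_add, map_smul, smul_eq_mul, Pi.add_apply, Pi.smul_apply]
  ring

/-- Contracting the first slot of a pencil element `s·(b₁⊗c₁) + t·(b₂⊗c₂)` (a 2-tensor) with a
functional `ψ`: `sψ(b₁)·c₁ + tψ(b₂)·c₂`. [folklore] -/
private theorem contractκ_pencil (ψ : Module.Dual K (κ → K)) (s t : K) (b₁ b₂ : κ → K)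
    (c₁ c₂ : μ → K) :
    (fun z => ψ (fun y => (s • (fun y z => b₁ y * c₁ z) + t • (fun y z => b₂ y * c₂ z)) y z)) =
      (s * ψ b₁) • c₁ + (t * ψ b₂) • c₂ := by
  funext z
  have hy : (fun y => (s • (fun y z => b₁ y * c₁ z) + t • (fun y z => b₂ y * c₂ z)) y z) =
      (s * c₁ z) • b₁ + (t * c₂ z) • b₂ := by
    funext y
    simp only [Pi.add_apply, Pi.smul_apply, smul_eq_mul]
    ring
  rw [hy]
  simp only [map_add, map_smul, smul_eq_mul, Pi.add_apply, Pi.smul_apply]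
  ring

/-- Contracting the second slot of a pencil element `s·(b₁⊗c₁) + t·(b₂⊗c₂)` with a functional
`χ`: `sχ(c₁)·b₁ + tχ(c₂)·b₂`. [folklore] -/
private theorem contractμ_pencil (χ : Module.Dual K (μ → K)) (s t : K) (b₁ b₂ : κ → K)
    (c₁ c₂ : μ → K) :
    (fun y => χ ((s • (fun y z => b₁ y * c₁ z) + t • (fun y z => b₂ y * c₂ z)) y)) =
      (s * χ c₁) • b₁ + (t * χ c₂) • b₂ := by
  funext y
  have hz : (s • (fun y z => b₁ y * c₁ z) + t • (fun y z => b₂ y * c₂ z)) y =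
      (s * b₁ y) • c₁ + (t * b₂ y) • c₂ := by
    funext z
    simp only [Pi.add_apply, Pi.smul_apply, smul_eq_mul]
    ring
  rw [hz]
  simp only [map_add, map_smul, smul_eq_mul, Pi.add_apply, Pi.smul_apply]
  ring

/-- Contracting the first slot of a single outer product `b⊗c`: `ψ(b)·c`. [folklore] -/
private theorem contractκ_single (ψ : Module.Dual K (κ → K)) (b : κ → K) (c : μ → K) :
    (fun z => ψ (fun y => b y * c z)) = ψ b • c := by
  funext z
  have hy : (fun y => b y * c z) = c z • b := by
    funext y; simp only [Pi.smul_apply, smul_eq_mul]; ring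
  rw [hy, map_smul, Pi.smul_apply, smul_eq_mul, smul_eq_mul, mul_comm]

/-! ## The pencil `⟨b₁⊗c₁, b₂⊗c₂⟩`: independence and its rank-one members -/

/-- `b₁⊗c₁` and `b₂⊗c₂` are linearly independent when `b₁, b₂` are and `c₁, c₂ ≠ 0`. [folklore] -/
private theorem pencil_independent {b₁ b₂ : κ → K} {c₁ c₂ : μ → K}
    (hb : LinearIndependent K ![b₁, b₂]) (hc₁ : c₁ ≠ 0) (hc₂ : c₂ ≠ 0) {s t : K}
    (h : s • (fun y z => b₁ y * c₁ z) + t • (fun y z => b₂ y * c₂ z) = 0) : s = 0 ∧ t = 0 := by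
  obtain ⟨ψ₁, h11, h12⟩ := exists_dual_pair hb
  obtain ⟨ψ₂, h21, h22⟩ := exists_dual_pair' hb
  have hz : ∀ ψ : Module.Dual K (κ → K), (fun z : μ => ψ (fun y : κ => (0 : κ → μ → K) y z)) = 0 :=
    fun ψ => by
      funext z
      change ψ 0 = 0
      exact map_zero ψ
  have e₁ := congrArg (fun M : κ → μ → K => fun z => ψ₁ (fun y => M y z)) h
  have e₂ := congrArg (fun M : κ → μ → K => fun z => ψ₂ (fun y => M y z)) h
  simp only [contractκ_pencil, h11, h12, h21, h22, mul_one, mul_zero, zero_smul, add_zero,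
    zero_add, hz] at e₁ e₂
  exact ⟨(smul_eq_zero.mp e₁).resolve_right hc₁, (smul_eq_zero.mp e₂).resolve_right hc₂⟩

/-- **The rank-one members of the pencil** `⟨b₁⊗c₁, b₂⊗c₂⟩` with `b₁,b₂` and `c₁,c₂` independent
are the multiples of `b₁⊗c₁` and of `b₂⊗c₂`: if `s·(b₁⊗c₁) + t·(b₂⊗c₂) = b⊗c` then `s = 0` or
`t = 0` (the contracted form of KM Lemma 5). [cite: KauersMoosbauer2022FlipGraphs, Lemma 5] -/
theorem pencil_rankOne {b₁ b₂ b : κ → K} {c₁ c₂ c : μ → K} (hb : LinearIndependent K ![b₁, b₂])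
    (hc : LinearIndependent K ![c₁, c₂]) {s t : K}
    (h : s • (fun y z => b₁ y * c₁ z) + t • (fun y z => b₂ y * c₂ z) = fun y z => b y * c z) :
    s = 0 ∨ t = 0 := by
  obtain ⟨ψ₁, h11, h12⟩ := exists_dual_pair hb
  obtain ⟨ψ₂, h21, h22⟩ := exists_dual_pair' hb
  have e₁ := congrArg (fun M : κ → μ → K => fun z => ψ₁ (fun y => M y z)) h
  have e₂ := congrArg (fun M : κ → μ → K => fun z => ψ₂ (fun y => M y z)) h
  simp only [contractκ_pencil, contractκ_single, h11, h12, h21, h22, mul_one, mul_zero, zero_smul,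
    add_zero, zero_add] at e₁ e₂
  -- `e₁ : s • c₁ = ψ₁ b • c`, `e₂ : t • c₂ = ψ₂ b • c`
  by_cases hψ : ψ₁ b = 0
  · left
    rw [hψ, zero_smul] at e₁
    exact (smul_eq_zero.mp e₁).resolve_right (by simpa using hc.ne_zero 0)
  · right
    have hcval : c = ((ψ₁ b)⁻¹ * s) • c₁ := by
      rw [mul_smul, e₁, smul_smul, inv_mul_cancel₀ hψ, one_smul]
    have hdep : (-(ψ₂ b * ((ψ₁ b)⁻¹ * s))) • c₁ + t • c₂ = 0 := by
      rw [e₂, hcval, smul_smul, neg_smul, neg_add_cancel]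
    exact ((LinearIndependent.pair_iff.mp hc) _ _ hdep).2

/-- Comparing coefficients along the pencil: if `p⊗b₁⊗c₁ + q⊗b₂⊗c₂ = p'⊗b₁⊗c₁ + q'⊗b₂⊗c₂` with
`b₁,b₂` independent and `c₁,c₂ ≠ 0`, then `p = p'` and `q = q'`. [folklore] -/
private theorem triad_pencil_coeff_eq {b₁ b₂ : κ → K} {c₁ c₂ : μ → K}
    (hb : LinearIndependent K ![b₁, b₂]) (hc₁ : c₁ ≠ 0) (hc₂ : c₂ ≠ 0) {p q p' q' : ι → K}
    (h : triad p b₁ c₁ + triad q b₂ c₂ = triad p' b₁ c₁ + triad q' b₂ c₂) : p = p' ∧ q = q' := by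
  suffices hx : ∀ x, p x = p' x ∧ q x = q' x from
    ⟨funext fun x => (hx x).1, funext fun x => (hx x).2⟩
  intro x
  have hx : (p x - p' x) • (fun y z => b₁ y * c₁ z) + (q x - q' x) • (fun y z => b₂ y * c₂ z) =
      0 := by
    funext y z
    have h' := congrFun (congrFun (congrFun h x) y) z
    simp only [Pi.add_apply, triad_apply] at h'
    simp only [Pi.add_apply, Pi.smul_apply, Pi.zero_apply, smul_eq_mul]
    linear_combination h'
  obtain ⟨h₁, h₂⟩ := pencil_independent hb hc₁ hc₂ hx
  exact ⟨sub_eq_zero.mp h₁, sub_eq_zero.mp h₂⟩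

/-- Transport along a proportionality of 2-tensors: if `b⊗c = s·(b'⊗c')` then
`a⊗b⊗c = (s·a)⊗b'⊗c'`. [folklore] -/
private theorem triad_eq_of_outer_eq_smul {a : ι → K} {b b' : κ → K} {c c' : μ → K} {s : K}
    (h : (fun y z => b y * c z) = s • (fun y z => b' y * c' z)) :
    triad a b c = triad (s • a) b' c' := by
  funext x y z
  have h' := congrFun (congrFun h y) z
  simp only [Pi.smul_apply, smul_eq_mul] at h'
  simp only [triad_apply, Pi.smul_apply, smul_eq_mul]
  rw [mul_assoc, h']
  ring

/-- If `v ≠ 0` and `v, w` are linearly DEpendent then `w` is a multiple of `v`. [folklore] -/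
private theorem exists_eq_smul_of_not_pair {V : Type*} [AddCommGroup V] [Module K V] {v w : V}
    (hv : v ≠ 0) (h : ¬ LinearIndependent K ![v, w]) : ∃ ρ : K, w = ρ • v := by
  rw [LinearIndependent.pair_iff' hv] at h
  push Not at h
  obtain ⟨ρ, hρ⟩ := h
  exact ⟨ρ, hρ.symm⟩

end Contract

/-! ## KM Thm. 7 -/

section Thm7

variable {ι κ μ : Type*}

/-- **Kauers–Moosbauer 2023, Thm. 7 (completeness of flips).** Let `a₁,…,a₄ ≠ 0`,
`b₃ ≠ 0`, `c₃ ≠ 0`, with `b₁, b₂` linearly independent and `c₁, c₂` linearly independent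
(`dim⟨B⁽¹⁾,B⁽²⁾⟩ = dim⟨Γ⁽¹⁾,Γ⁽²⁾⟩ = 2`), and
`a₁⊗b₁⊗c₁ + a₂⊗b₂⊗c₂ = a₃⊗b₃⊗c₃ + a₄⊗b₄⊗c₄` with `{a₁⊗b₁⊗c₁, a₂⊗b₂⊗c₂} ≠ {a₃⊗b₃⊗c₃, a₄⊗b₄⊗c₄}`.
Then (1) `dim⟨a₁,a₂,a₃,a₄⟩ = 1`, (2) `⟨b₁,b₂⟩ = ⟨b₃,b₄⟩`, (3) `⟨c₁,c₂⟩ = ⟨c₃,c₄⟩`.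
KM assume all twelve vectors non-zero; `B⁽¹⁾,B⁽²⁾,Γ⁽¹⁾,Γ⁽²⁾ ≠ 0` follow from independence and
`B⁽⁴⁾, Γ⁽⁴⁾ ≠ 0` turn out not to be needed (the statement here is the printed one with these four
hypotheses dropped). [cite: KauersMoosbauer2022FlipGraphs, Thm. 7 (with Lemma 5, Lemma 6)] -/
theorem kauersMoosbauer2023_thm7 (a₁ a₂ a₃ a₄ : ι → K) (b₁ b₂ b₃ b₄ : κ → K)
    (c₁ c₂ c₃ c₄ : μ → K) (ha₁ : a₁ ≠ 0) (ha₂ : a₂ ≠ 0) (ha₃ : a₃ ≠ 0) (ha₄ : a₄ ≠ 0)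
    (hb₃ : b₃ ≠ 0) (hc₃ : c₃ ≠ 0)
    (hb : LinearIndependent K ![b₁, b₂]) (hc : LinearIndependent K ![c₁, c₂])
    (hsum : triad a₁ b₁ c₁ + triad a₂ b₂ c₂ = triad a₃ b₃ c₃ + triad a₄ b₄ c₄)
    (hne : ({triad a₁ b₁ c₁, triad a₂ b₂ c₂} : Set (ι → κ → μ → K)) ≠
      {triad a₃ b₃ c₃, triad a₄ b₄ c₄}) :
    Module.finrank K (Submodule.span K ({a₁, a₂, a₃, a₄} : Set (ι → K))) = 1 ∧
      Submodule.span K ({b₁, b₂} : Set (κ → K)) = Submodule.span K {b₃, b₄} ∧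
      Submodule.span K ({c₁, c₂} : Set (μ → K)) = Submodule.span K {c₃, c₄} := by
  have hc₁ : c₁ ≠ 0 := by simpa using hc.ne_zero 0
  have hc₂ : c₂ ≠ 0 := by simpa using hc.ne_zero 1
  -- dual functionals of the independent pairs `b₁,b₂` and `c₁,c₂`
  obtain ⟨ψ₁, hψ₁1, hψ₁2⟩ := exists_dual_pair hb
  obtain ⟨ψ₂, hψ₂1, hψ₂2⟩ := exists_dual_pair' hb
  obtain ⟨χ₁, hχ₁1, hχ₁2⟩ := exists_dual_pair hc
  obtain ⟨χ₂, hχ₂1, hχ₂2⟩ := exists_dual_pair' hc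
  -- Step 1: `a₁, a₂ ∈ ⟨a₃, a₄⟩`, by contracting slots 2 and 3.
  have ea₁ : a₁ = (ψ₁ b₃ * χ₁ c₃) • a₃ + (ψ₁ b₄ * χ₁ c₄) • a₄ := by
    have e := congrArg
      (fun t : ι → κ → μ → K => fun x => χ₁ (fun z => ψ₁ (fun y => t x y z))) hsum
    simp only [contract₂₃_pair, hψ₁1, hψ₁2, hχ₁1, hχ₁2, mul_one, mul_zero, one_smul,
      zero_smul, add_zero] at e
    exact e
  have ea₂ : a₂ = (ψ₂ b₃ * χ₂ c₃) • a₃ + (ψ₂ b₄ * χ₂ c₄) • a₄ := by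
    have e := congrArg
      (fun t : ι → κ → μ → K => fun x => χ₂ (fun z => ψ₂ (fun y => t x y z))) hsum
    simp only [contract₂₃_pair, hψ₂1, hψ₂2, hχ₂1, hχ₂2, mul_one, mul_zero, one_smul,
      zero_smul, zero_add] at e
    exact e
  -- Step 2 (KM Lemma 5, contracted): `a₃, a₄` cannot be independent.
  have hdep : ¬ LinearIndependent K ![a₃, a₄] := by
    intro h34
    obtain ⟨θ₃, hθ₃3, hθ₃4⟩ := exists_dual_pair h34
    obtain ⟨θ₄, hθ₄3, hθ₄4⟩ := exists_dual_pair' h34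
    have m₃ : θ₃ a₁ • (fun y z => b₁ y * c₁ z) + θ₃ a₂ • (fun y z => b₂ y * c₂ z) =
        fun y z => b₃ y * c₃ z := by
      have e := congrArg (fun t : ι → κ → μ → K => fun y z => θ₃ (fun x => t x y z)) hsum
      simp only [contract₁_pair, hθ₃3, hθ₃4, one_smul, zero_smul, add_zero] at e
      exact e
    have m₄ : θ₄ a₁ • (fun y z => b₁ y * c₁ z) + θ₄ a₂ • (fun y z => b₂ y * c₂ z) =
        fun y z => b₄ y * c₄ z := by
      have e := congrArg (fun t : ι → κ → μ → K => fun y z => θ₄ (fun x => t x y z)) hsum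
      simp only [contract₁_pair, hθ₄3, hθ₄4, one_smul, zero_smul, zero_add] at e
      exact e
    rcases pencil_rankOne hb hc m₃ with h31 | h32 <;> rcases pencil_rankOne hb hc m₄ with h41 | h42
    · -- `b₃⊗c₃, b₄⊗c₄ ∥ b₂⊗c₂`: then `a₁ = 0`.
      rw [h31, zero_smul, zero_add] at m₃
      rw [h41, zero_smul, zero_add] at m₄
      have e3 := triad_eq_of_outer_eq_smul (a := a₃) m₃.symm
      have e4 := triad_eq_of_outer_eq_smul (a := a₄) m₄.symm
      have key : triad a₁ b₁ c₁ + triad a₂ b₂ c₂ =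
          triad 0 b₁ c₁ + triad (θ₃ a₂ • a₃ + θ₄ a₂ • a₄) b₂ c₂ := by
        rw [hsum, e3, e4]
        funext x y z
        simp only [Pi.add_apply, triad_apply, Pi.smul_apply, Pi.zero_apply, smul_eq_mul]
        ring
      exact ha₁ (triad_pencil_coeff_eq hb hc₁ hc₂ key).1
    · -- `b₃⊗c₃ ∥ b₂⊗c₂`, `b₄⊗c₄ ∥ b₁⊗c₁`: then `T₃ = T₂`, `T₄ = T₁`.
      rw [h31, zero_smul, zero_add] at m₃
      rw [h42, zero_smul, add_zero] at m₄
      have e3 := triad_eq_of_outer_eq_smul (a := a₃) m₃.symm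
      have e4 := triad_eq_of_outer_eq_smul (a := a₄) m₄.symm
      have key : triad a₁ b₁ c₁ + triad a₂ b₂ c₂ =
          triad (θ₄ a₁ • a₄) b₁ c₁ + triad (θ₃ a₂ • a₃) b₂ c₂ := by
        rw [hsum, e3, e4, add_comm]
      obtain ⟨h₁, h₂⟩ := triad_pencil_coeff_eq hb hc₁ hc₂ key
      refine hne ?_
      rw [e3, e4, ← h₁, ← h₂, Set.pair_comm]
    · -- `b₃⊗c₃ ∥ b₁⊗c₁`, `b₄⊗c₄ ∥ b₂⊗c₂`: then `T₃ = T₁`, `T₄ = T₂`.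
      rw [h32, zero_smul, add_zero] at m₃
      rw [h41, zero_smul, zero_add] at m₄
      have e3 := triad_eq_of_outer_eq_smul (a := a₃) m₃.symm
      have e4 := triad_eq_of_outer_eq_smul (a := a₄) m₄.symm
      have key : triad a₁ b₁ c₁ + triad a₂ b₂ c₂ =
          triad (θ₃ a₁ • a₃) b₁ c₁ + triad (θ₄ a₂ • a₄) b₂ c₂ := by
        rw [hsum, e3, e4]
      obtain ⟨h₁, h₂⟩ := triad_pencil_coeff_eq hb hc₁ hc₂ key
      refine hne ?_
      rw [e3, e4, ← h₁, ← h₂]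
    · -- `b₃⊗c₃, b₄⊗c₄ ∥ b₁⊗c₁`: then `a₂ = 0`.
      rw [h32, zero_smul, add_zero] at m₃
      rw [h42, zero_smul, add_zero] at m₄
      have e3 := triad_eq_of_outer_eq_smul (a := a₃) m₃.symm
      have e4 := triad_eq_of_outer_eq_smul (a := a₄) m₄.symm
      have key : triad a₁ b₁ c₁ + triad a₂ b₂ c₂ =
          triad (θ₃ a₁ • a₃ + θ₄ a₁ • a₄) b₁ c₁ + triad 0 b₂ c₂ := by
        rw [hsum, e3, e4]
        funext x y z
        simp only [Pi.add_apply, triad_apply, Pi.smul_apply, Pi.zero_apply, smul_eq_mul]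
        ring
      exact ha₂ (triad_pencil_coeff_eq hb hc₁ hc₂ key).2
  -- Step 3: all `aᵢ` lie on the line `K ∙ a₃`.
  obtain ⟨l₄, ha₄l⟩ := exists_eq_smul_of_not_pair ha₃ hdep
  set l₁ : K := ψ₁ b₃ * χ₁ c₃ + ψ₁ b₄ * χ₁ c₄ * l₄ with hl₁def
  set l₂ : K := ψ₂ b₃ * χ₂ c₃ + ψ₂ b₄ * χ₂ c₄ * l₄ with hl₂def
  have ha₁l : a₁ = l₁ • a₃ := by rw [ea₁, ha₄l, smul_smul, ← add_smul]
  have ha₂l : a₂ = l₂ • a₃ := by rw [ea₂, ha₄l, smul_smul, ← add_smul]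
  have hl₁ : l₁ ≠ 0 := by rintro h0; exact ha₁ (by rw [ha₁l, h0, zero_smul])
  have hl₂ : l₂ ≠ 0 := by rintro h0; exact ha₂ (by rw [ha₂l, h0, zero_smul])
  have hl₄ : l₄ ≠ 0 := by rintro h0; exact ha₄ (by rw [ha₄l, h0, zero_smul])
  have claim₁ : Module.finrank K (Submodule.span K ({a₁, a₂, a₃, a₄} : Set (ι → K))) = 1 := by
    have hspan : Submodule.span K ({a₁, a₂, a₃, a₄} : Set (ι → K)) = K ∙ a₃ := by
      apply le_antisymm
      · rw [Submodule.span_le]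
        intro v hv
        simp only [Set.mem_insert_iff, Set.mem_singleton_iff] at hv
        rcases hv with rfl | rfl | rfl | rfl
        · exact Submodule.mem_span_singleton.mpr ⟨l₁, ha₁l.symm⟩
        · exact Submodule.mem_span_singleton.mpr ⟨l₂, ha₂l.symm⟩
        · exact Submodule.mem_span_singleton_self _
        · exact Submodule.mem_span_singleton.mpr ⟨l₄, ha₄l.symm⟩
      · rw [Submodule.span_le, Set.singleton_subset_iff]
        exact Submodule.subset_span (by simp)
    rw [hspan, finrank_span_singleton ha₃]
  -- Step 4: contract the first slot with `θ`, `θ a₃ = 1`: KM's matrix identity (Lemma 6 input)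
  -- `l₁·(b₁⊗c₁) + l₂·(b₂⊗c₂) = 1·(b₃⊗c₃) + l₄·(b₄⊗c₄)`.
  obtain ⟨θ, hθ⟩ := Module.Projective.exists_dual_eq_one K ha₃
  have N : l₁ • (fun y z => b₁ y * c₁ z) + l₂ • (fun y z => b₂ y * c₂ z) =
      (1 : K) • (fun y z => b₃ y * c₃ z) + l₄ • (fun y z => b₄ y * c₄ z) := by
    have e := congrArg (fun t : ι → κ → μ → K => fun y z => θ (fun x => t x y z)) hsum
    simp only [contract₁_pair] at e
    rw [ha₁l, ha₂l, ha₄l, map_smul, map_smul, map_smul, hθ, smul_eq_mul, smul_eq_mul,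
      smul_eq_mul, mul_one, mul_one, mul_one] at e
    exact e
  -- Step 5 (KM Lemma 6): `b₃, b₄` and `c₃, c₄` are independent too (pencil lemma) …
  have hc34 : LinearIndependent K ![c₃, c₄] := by
    by_contra h
    obtain ⟨ρ, hρ⟩ := exists_eq_smul_of_not_pair hc₃ h
    have single : (1 : K) • (fun y z => b₃ y * c₃ z) + l₄ • (fun y z => b₄ y * c₄ z) =
        fun y z => (b₃ + (l₄ * ρ) • b₄) y * c₃ z := by
      funext y z
      simp only [hρ, Pi.add_apply, Pi.smul_apply, smul_eq_mul]
      ring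
    rcases pencil_rankOne hb hc (N.trans single) with h0 | h0
    · exact hl₁ h0
    · exact hl₂ h0
  have hb34 : LinearIndependent K ![b₃, b₄] := by
    by_contra h
    obtain ⟨ρ, hρ⟩ := exists_eq_smul_of_not_pair hb₃ h
    have single : (1 : K) • (fun y z => b₃ y * c₃ z) + l₄ • (fun y z => b₄ y * c₄ z) =
        fun y z => b₃ y * (c₃ + (l₄ * ρ) • c₄) z := by
      funext y z
      simp only [hρ, Pi.add_apply, Pi.smul_apply, smul_eq_mul]
      ring
    rcases pencil_rankOne hb hc (N.trans single) with h0 | h0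
    · exact hl₁ h0
    · exact hl₂ h0
  obtain ⟨ψ₃, hψ₃3, hψ₃4⟩ := exists_dual_pair hb34
  obtain ⟨ψ₄, hψ₄3, hψ₄4⟩ := exists_dual_pair' hb34
  obtain ⟨χ₃, hχ₃3, hχ₃4⟩ := exists_dual_pair hc34
  obtain ⟨χ₄, hχ₄3, hχ₄4⟩ := exists_dual_pair' hc34
  -- … and contracting `N` with the eight dual functionals gives the four + four memberships.
  have Nμ : ∀ χ : Module.Dual K (μ → K), (l₁ * χ c₁) • b₁ + (l₂ * χ c₂) • b₂ =
      (1 * χ c₃) • b₃ + (l₄ * χ c₄) • b₄ := fun χ => by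
    have e := congrArg (fun M : κ → μ → K => fun y => χ (M y)) N
    simpa only [contractμ_pencil] using e
  have Nκ : ∀ ψ : Module.Dual K (κ → K), (l₁ * ψ b₁) • c₁ + (l₂ * ψ b₂) • c₂ =
      (1 * ψ b₃) • c₃ + (l₄ * ψ b₄) • c₄ := fun ψ => by
    have e := congrArg (fun M : κ → μ → K => fun z => ψ (fun y => M y z)) N
    simpa only [contractκ_pencil] using e
  have claim₂ : Submodule.span K ({b₁, b₂} : Set (κ → K)) = Submodule.span K {b₃, b₄} := by
    apply le_antisymm
    · rw [Submodule.span_le, Set.insert_subset_iff, Set.singleton_subset_iff]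
      refine ⟨?_, ?_⟩
      · have e := Nμ χ₁
        rw [hχ₁1, hχ₁2, mul_one, mul_zero, zero_smul, add_zero] at e
        have hm : l₁ • b₁ ∈ Submodule.span K ({b₃, b₄} : Set (κ → K)) :=
          Submodule.mem_span_pair.mpr ⟨_, _, e.symm⟩
        exact (Submodule.smul_mem_iff _ hl₁).mp hm
      · have e := Nμ χ₂
        rw [hχ₂1, hχ₂2, mul_one, mul_zero, zero_smul, zero_add] at e
        have hm : l₂ • b₂ ∈ Submodule.span K ({b₃, b₄} : Set (κ → K)) :=
          Submodule.mem_span_pair.mpr ⟨_, _, e.symm⟩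
        exact (Submodule.smul_mem_iff _ hl₂).mp hm
    · rw [Submodule.span_le, Set.insert_subset_iff, Set.singleton_subset_iff]
      refine ⟨?_, ?_⟩
      · have e := Nμ χ₃
        rw [hχ₃3, hχ₃4, mul_one, mul_zero, zero_smul, add_zero, one_smul] at e
        exact Submodule.mem_span_pair.mpr ⟨_, _, e⟩
      · have e := Nμ χ₄
        rw [hχ₄3, hχ₄4, mul_zero, zero_smul, zero_add, mul_one] at e
        have hm : l₄ • b₄ ∈ Submodule.span K ({b₁, b₂} : Set (κ → K)) :=
          Submodule.mem_span_pair.mpr ⟨_, _, e⟩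
        exact (Submodule.smul_mem_iff _ hl₄).mp hm
  have claim₃ : Submodule.span K ({c₁, c₂} : Set (μ → K)) = Submodule.span K {c₃, c₄} := by
    apply le_antisymm
    · rw [Submodule.span_le, Set.insert_subset_iff, Set.singleton_subset_iff]
      refine ⟨?_, ?_⟩
      · have e := Nκ ψ₁
        rw [hψ₁1, hψ₁2, mul_one, mul_zero, zero_smul, add_zero] at e
        have hm : l₁ • c₁ ∈ Submodule.span K ({c₃, c₄} : Set (μ → K)) :=
          Submodule.mem_span_pair.mpr ⟨_, _, e.symm⟩
        exact (Submodule.smul_mem_iff _ hl₁).mp hm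
      · have e := Nκ ψ₂
        rw [hψ₂1, hψ₂2, mul_one, mul_zero, zero_smul, zero_add] at e
        have hm : l₂ • c₂ ∈ Submodule.span K ({c₃, c₄} : Set (μ → K)) :=
          Submodule.mem_span_pair.mpr ⟨_, _, e.symm⟩
        exact (Submodule.smul_mem_iff _ hl₂).mp hm
    · rw [Submodule.span_le, Set.insert_subset_iff, Set.singleton_subset_iff]
      refine ⟨?_, ?_⟩
      · have e := Nκ ψ₃
        rw [hψ₃3, hψ₃4, mul_one, mul_zero, zero_smul, add_zero, one_smul] at e
        exact Submodule.mem_span_pair.mpr ⟨_, _, e⟩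
      · have e := Nκ ψ₄
        rw [hψ₄3, hψ₄4, mul_zero, zero_smul, zero_add, mul_one] at e
        have hm : l₄ • c₄ ∈ Submodule.span K ({c₁, c₂} : Set (μ → K)) :=
          Submodule.mem_span_pair.mpr ⟨_, _, e⟩
        exact (Submodule.smul_mem_iff _ hl₄).mp hm
  exact ⟨claim₁, claim₂, claim₃⟩

end Thm7

/-! ## KM Lemma 5 and Lemma 6 as printed -/

section Lemmas

variable {ι κ μ : Type*}

/-- A triad with first factor `0` vanishes (bookkeeping). [folklore] -/
private theorem triad_zero₁ (b : κ → K) (c : μ → K) : triad (0 : ι → K) b c = 0 := by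
  funext x y z; simp only [triad_apply, Pi.zero_apply, zero_mul]

/-- A triad with second factor `0` vanishes (bookkeeping). [folklore] -/
private theorem triad_zero₂ (a : ι → K) (c : μ → K) : triad a (0 : κ → K) c = 0 := by
  funext x y z; simp only [triad_apply, Pi.zero_apply, mul_zero, zero_mul]

/-- A triad with third factor `0` vanishes (bookkeeping). [folklore] -/
private theorem triad_zero₃ (a : ι → K) (b : κ → K) : triad a b (0 : μ → K) = 0 := by
  funext x y z; simp only [triad_apply, Pi.zero_apply, mul_zero]

/-- Two rank-one tensors with independent first factors, independent second factors and non-zero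
third factors never sum to a single rank-one tensor (or to `0`): the rank-`2` obstruction used
tacitly throughout KM §3 ("the left side would also have rank `1`"). [folklore] -/
private theorem triad_add_triad_ne_triad {a₁ a₂ a : ι → K} {b₁ b₂ b : κ → K} {c₁ c₂ c : μ → K}
    (ha : LinearIndependent K ![a₁, a₂]) (hb : LinearIndependent K ![b₁, b₂]) (hc₁ : c₁ ≠ 0)
    (hc₂ : c₂ ≠ 0) : triad a₁ b₁ c₁ + triad a₂ b₂ c₂ ≠ triad a b c := by
  intro h
  have h' : triad a₁ b₁ c₁ + triad a₂ b₂ c₂ = triad a b c + triad 0 b c := by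
    rw [h, triad_zero₁, add_zero]
  obtain ⟨φ₁, h11, h12⟩ := exists_dual_pair ha
  obtain ⟨φ₂, h21, h22⟩ := exists_dual_pair' ha
  have m₁ := congrArg (fun t : ι → κ → μ → K => fun y z => φ₁ (fun x => t x y z)) h'
  have m₂ := congrArg (fun t : ι → κ → μ → K => fun y z => φ₂ (fun x => t x y z)) h'
  simp only [contract₁_pair, h11, h12, h21, h22, map_zero, one_smul, zero_smul, add_zero,
    zero_add] at m₁ m₂
  -- `m₁ : b₁⊗c₁ = φ₁(a)·(b⊗c)`, `m₂ : b₂⊗c₂ = φ₂(a)·(b⊗c)`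
  by_cases hφ : φ₁ a = 0
  · rw [hφ, zero_smul] at m₁
    have e : (1 : K) • (fun y z => b₁ y * c₁ z) + (0 : K) • (fun y z => b₂ y * c₂ z) = 0 := by
      rw [one_smul, zero_smul, add_zero, m₁]
    exact one_ne_zero (pencil_independent hb hc₁ hc₂ e).1
  · have hM : (fun y z => b y * c z) = (φ₁ a)⁻¹ • (fun y z => b₁ y * c₁ z) := by
      rw [m₁, smul_smul, inv_mul_cancel₀ hφ, one_smul]
    have e : (-(φ₂ a * (φ₁ a)⁻¹)) • (fun y z => b₁ y * c₁ z) +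
        (1 : K) • (fun y z => b₂ y * c₂ z) = 0 := by
      rw [one_smul, m₂, hM, smul_smul, neg_smul, neg_add_cancel]
    exact one_ne_zero (pencil_independent hb hc₁ hc₂ e).2

/-- **Kauers–Moosbauer 2023, Lemma 5** (uniqueness of a `2 + 2` identity with all factor pairs
independent). Let `A⁽ⁱ⁾ ∈ U`, `B⁽ⁱ⁾ ∈ V`, `Γ⁽ⁱ⁾ ∈ W` (`i = 1,…,4`) with
`A⁽¹⁾⊗B⁽¹⁾⊗Γ⁽¹⁾ + A⁽²⁾⊗B⁽²⁾⊗Γ⁽²⁾ = A⁽³⁾⊗B⁽³⁾⊗Γ⁽³⁾ + A⁽⁴⁾⊗B⁽⁴⁾⊗Γ⁽⁴⁾` and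
`dim⟨A⁽¹⁾,A⁽²⁾⟩ = dim⟨B⁽¹⁾,B⁽²⁾⟩ = dim⟨Γ⁽¹⁾,Γ⁽²⁾⟩ = 2`. Then
`{A⁽¹⁾⊗B⁽¹⁾⊗Γ⁽¹⁾, A⁽²⁾⊗B⁽²⁾⊗Γ⁽²⁾} = {A⁽³⁾⊗B⁽³⁾⊗Γ⁽³⁾, A⁽⁴⁾⊗B⁽⁴⁾⊗Γ⁽⁴⁾}`. (KM prove it by "a
straightforward computation" on eight cubic equations; here it is read off Thm. 7 (1), whose
conclusion `dim⟨A⁽¹⁾,…,A⁽⁴⁾⟩ = 1` is incompatible with `dim⟨A⁽¹⁾,A⁽²⁾⟩ = 2`, after disposing of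
zero factors by the rank-`2` obstruction.) [cite: KauersMoosbauer2022FlipGraphs, Lemma 5] -/
theorem kauersMoosbauer2023_lem5 (a₁ a₂ a₃ a₄ : ι → K) (b₁ b₂ b₃ b₄ : κ → K)
    (c₁ c₂ c₃ c₄ : μ → K)
    (hsum : triad a₁ b₁ c₁ + triad a₂ b₂ c₂ = triad a₃ b₃ c₃ + triad a₄ b₄ c₄)
    (ha : LinearIndependent K ![a₁, a₂]) (hb : LinearIndependent K ![b₁, b₂])
    (hc : LinearIndependent K ![c₁, c₂]) :
    ({triad a₁ b₁ c₁, triad a₂ b₂ c₂} : Set (ι → κ → μ → K)) =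
      {triad a₃ b₃ c₃, triad a₄ b₄ c₄} := by
  by_contra hne
  have ha₁ : a₁ ≠ 0 := by simpa using ha.ne_zero 0
  have ha₂ : a₂ ≠ 0 := by simpa using ha.ne_zero 1
  have hc₁ : c₁ ≠ 0 := by simpa using hc.ne_zero 0
  have hc₂ : c₂ ≠ 0 := by simpa using hc.ne_zero 1
  have key : ∀ {a : ι → K} {b : κ → K} {c : μ → K},
      triad a₁ b₁ c₁ + triad a₂ b₂ c₂ ≠ triad a b c :=
    triad_add_triad_ne_triad ha hb hc₁ hc₂
  have ha₃ : a₃ ≠ 0 := by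
    rintro rfl
    exact key (a := a₄) (b := b₄) (c := c₄) (by rw [hsum, triad_zero₁, zero_add])
  have ha₄ : a₄ ≠ 0 := by
    rintro rfl
    exact key (a := a₃) (b := b₃) (c := c₃) (by rw [hsum, triad_zero₁, add_zero])
  have hb₃ : b₃ ≠ 0 := by
    rintro rfl
    exact key (a := a₄) (b := b₄) (c := c₄) (by rw [hsum, triad_zero₂, zero_add])
  have hc₃ : c₃ ≠ 0 := by
    rintro rfl
    exact key (a := a₄) (b := b₄) (c := c₄) (by rw [hsum, triad_zero₃, zero_add])
  obtain ⟨h1, -, -⟩ := kauersMoosbauer2023_thm7 a₁ a₂ a₃ a₄ b₁ b₂ b₃ b₄ c₁ c₂ c₃ c₄ ha₁ ha₂ ha₃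
    ha₄ hb₃ hc₃ hb hc hsum hne
  -- `dim ⟨a₁, a₂⟩ = 2 ≤ dim ⟨a₁, a₂, a₃, a₄⟩ = 1`: contradiction.
  have h2 : Module.finrank K (Submodule.span K (Set.range ![a₁, a₂])) = 2 := by
    rw [finrank_span_eq_card ha, Fintype.card_fin]
  have hle : Submodule.span K (Set.range ![a₁, a₂]) ≤
      Submodule.span K ({a₁, a₂, a₃, a₄} : Set (ι → K)) := by
    refine Submodule.span_mono ?_
    rintro _ ⟨i, rfl⟩
    fin_cases i <;> simp
  haveI : Module.Finite K (Submodule.span K ({a₁, a₂, a₃, a₄} : Set (ι → K))) :=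
    Module.finite_of_finrank_pos (by omega)
  have hmono := LinearMap.finrank_le_finrank_of_injective (Submodule.inclusion_injective hle)
  omega

/-- **Kauers–Moosbauer 2023, Lemma 6.** Let `B⁽¹⁾,…,B⁽⁴⁾ ∈ U` and `Γ⁽¹⁾,…,Γ⁽⁴⁾ ∈ V` with
`B⁽¹⁾⊗Γ⁽¹⁾ + B⁽²⁾⊗Γ⁽²⁾ = B⁽³⁾⊗Γ⁽³⁾ + B⁽⁴⁾⊗Γ⁽⁴⁾`, `dim⟨B⁽¹⁾,B⁽²⁾⟩ = dim⟨Γ⁽¹⁾,Γ⁽²⁾⟩ = 2` and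
`Γ⁽³⁾, Γ⁽⁴⁾ ≠ 0`. Then `⟨B⁽¹⁾,B⁽²⁾⟩ = ⟨B⁽³⁾,B⁽⁴⁾⟩` and `⟨Γ⁽¹⁾,Γ⁽²⁾⟩ = ⟨Γ⁽³⁾,Γ⁽⁴⁾⟩`. Matrices
`B ⊗ Γ` are the functions `fun y z => B y * Γ z`. (KM's proof: a dependence among `B⁽¹⁾,…,B⁽⁴⁾`
and independence of `Γ⁽¹⁾, Γ⁽²⁾`; here the memberships are read off by contracting with dual
functionals, the reverse inclusions using that `B⁽³⁾,B⁽⁴⁾` and `Γ⁽³⁾,Γ⁽⁴⁾` are themselves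
independent by the pencil lemma. KM's hypothesis `Γ⁽⁴⁾ ≠ 0` is not needed and is omitted;
"`dim = 2`" is rendered as `LinearIndependent K ![·, ·]`.) [cite: KauersMoosbauer2022FlipGraphs, Lemma 6] -/
theorem kauersMoosbauer2023_lem6 (b₁ b₂ b₃ b₄ : κ → K) (c₁ c₂ c₃ c₄ : μ → K)
    (hsum : ((fun y z => b₁ y * c₁ z) + fun y z => b₂ y * c₂ z) =
      (fun y z => b₃ y * c₃ z) + fun y z => b₄ y * c₄ z)
    (hb : LinearIndependent K ![b₁, b₂]) (hc : LinearIndependent K ![c₁, c₂]) (hc₃ : c₃ ≠ 0) :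
    Submodule.span K ({b₁, b₂} : Set (κ → K)) = Submodule.span K {b₃, b₄} ∧
      Submodule.span K ({c₁, c₂} : Set (μ → K)) = Submodule.span K {c₃, c₄} := by
  -- the identity with explicit scalars, to match the pencil lemmas
  have N : (1 : K) • (fun y z => b₁ y * c₁ z) + (1 : K) • (fun y z => b₂ y * c₂ z) =
      (1 : K) • (fun y z => b₃ y * c₃ z) + (1 : K) • (fun y z => b₄ y * c₄ z) := by
    simp only [one_smul]; exact hsum
  have hb₃ : b₃ ≠ 0 := by
    rintro rfl
    have single : (1 : K) • (fun y z => b₁ y * c₁ z) + (1 : K) • (fun y z => b₂ y * c₂ z) =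
        fun y z => b₄ y * c₄ z := by
      rw [N]; funext y z
      simp only [Pi.add_apply, Pi.smul_apply, Pi.zero_apply, smul_eq_mul]; ring
    rcases pencil_rankOne hb hc single with h | h <;> exact one_ne_zero h
  have hc34 : LinearIndependent K ![c₃, c₄] := by
    by_contra h
    obtain ⟨ρ, hρ⟩ := exists_eq_smul_of_not_pair hc₃ h
    have single : (1 : K) • (fun y z => b₁ y * c₁ z) + (1 : K) • (fun y z => b₂ y * c₂ z) =
        fun y z => (b₃ + ρ • b₄) y * c₃ z := by
      rw [N]; funext y z
      simp only [hρ, Pi.add_apply, Pi.smul_apply, smul_eq_mul]; ring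
    rcases pencil_rankOne hb hc single with h0 | h0 <;> exact one_ne_zero h0
  have hb34 : LinearIndependent K ![b₃, b₄] := by
    by_contra h
    obtain ⟨ρ, hρ⟩ := exists_eq_smul_of_not_pair hb₃ h
    have single : (1 : K) • (fun y z => b₁ y * c₁ z) + (1 : K) • (fun y z => b₂ y * c₂ z) =
        fun y z => b₃ y * (c₃ + ρ • c₄) z := by
      rw [N]; funext y z
      simp only [hρ, Pi.add_apply, Pi.smul_apply, smul_eq_mul]; ring
    rcases pencil_rankOne hb hc single with h0 | h0 <;> exact one_ne_zero h0
  obtain ⟨ψ₁, hψ₁1, hψ₁2⟩ := exists_dual_pair hb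
  obtain ⟨ψ₂, hψ₂1, hψ₂2⟩ := exists_dual_pair' hb
  obtain ⟨χ₁, hχ₁1, hχ₁2⟩ := exists_dual_pair hc
  obtain ⟨χ₂, hχ₂1, hχ₂2⟩ := exists_dual_pair' hc
  obtain ⟨ψ₃, hψ₃3, hψ₃4⟩ := exists_dual_pair hb34
  obtain ⟨ψ₄, hψ₄3, hψ₄4⟩ := exists_dual_pair' hb34
  obtain ⟨χ₃, hχ₃3, hχ₃4⟩ := exists_dual_pair hc34
  obtain ⟨χ₄, hχ₄3, hχ₄4⟩ := exists_dual_pair' hc34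
  have Nμ : ∀ χ : Module.Dual K (μ → K), (1 * χ c₁) • b₁ + (1 * χ c₂) • b₂ =
      (1 * χ c₃) • b₃ + (1 * χ c₄) • b₄ := fun χ => by
    have e := congrArg (fun M : κ → μ → K => fun y => χ (M y)) N
    simpa only [contractμ_pencil] using e
  have Nκ : ∀ ψ : Module.Dual K (κ → K), (1 * ψ b₁) • c₁ + (1 * ψ b₂) • c₂ =
      (1 * ψ b₃) • c₃ + (1 * ψ b₄) • c₄ := fun ψ => by
    have e := congrArg (fun M : κ → μ → K => fun z => ψ (fun y => M y z)) N
    simpa only [contractκ_pencil] using e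
  refine ⟨?_, ?_⟩
  · apply le_antisymm
    · rw [Submodule.span_le, Set.insert_subset_iff, Set.singleton_subset_iff]
      refine ⟨?_, ?_⟩
      · have e := Nμ χ₁
        simp only [hχ₁1, hχ₁2, one_mul, one_smul, zero_smul, add_zero] at e
        exact Submodule.mem_span_pair.mpr ⟨_, _, e.symm⟩
      · have e := Nμ χ₂
        simp only [hχ₂1, hχ₂2, one_mul, one_smul, zero_smul, zero_add] at e
        exact Submodule.mem_span_pair.mpr ⟨_, _, e.symm⟩
    · rw [Submodule.span_le, Set.insert_subset_iff, Set.singleton_subset_iff]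
      refine ⟨?_, ?_⟩
      · have e := Nμ χ₃
        simp only [hχ₃3, hχ₃4, one_mul, one_smul, zero_smul, add_zero] at e
        exact Submodule.mem_span_pair.mpr ⟨_, _, e⟩
      · have e := Nμ χ₄
        simp only [hχ₄3, hχ₄4, one_mul, one_smul, zero_smul, zero_add] at e
        exact Submodule.mem_span_pair.mpr ⟨_, _, e⟩
  · apply le_antisymm
    · rw [Submodule.span_le, Set.insert_subset_iff, Set.singleton_subset_iff]
      refine ⟨?_, ?_⟩
      · have e := Nκ ψ₁
        simp only [hψ₁1, hψ₁2, one_mul, one_smul, zero_smul, add_zero] at e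
        exact Submodule.mem_span_pair.mpr ⟨_, _, e.symm⟩
      · have e := Nκ ψ₂
        simp only [hψ₂1, hψ₂2, one_mul, one_smul, zero_smul, zero_add] at e
        exact Submodule.mem_span_pair.mpr ⟨_, _, e.symm⟩
    · rw [Submodule.span_le, Set.insert_subset_iff, Set.singleton_subset_iff]
      refine ⟨?_, ?_⟩
      · have e := Nκ ψ₃
        simp only [hψ₃3, hψ₃4, one_mul, one_smul, zero_smul, add_zero] at e
        exact Submodule.mem_span_pair.mpr ⟨_, _, e⟩
      · have e := Nκ ψ₄
        simp only [hψ₄3, hψ₄4, one_mul, one_smul, zero_smul, zero_add] at e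
        exact Submodule.mem_span_pair.mpr ⟨_, _, e⟩

end Lemmas

end Field

/-! ## KM Cor. 10 (tensor form): over `ℤ₂` the only two-element replacement is a flip -/

section TwoElements

variable {K : Type*} [Field K] {ι κ μ : Type*}

/-- In a field with two elements, `1 + 1 = 0`. [folklore] -/
private theorem one_add_one_of_two (hK : ∀ x : K, x = 0 ∨ x = 1) : (1 : K) + 1 = 0 := by
  rcases hK (1 + 1) with h | h
  · exact h
  · exact absurd (by linear_combination h) (one_ne_zero (α := K))

/-- In a field with two elements, `x - y = x + y`. [folklore] -/
private theorem sub_eq_add_of_two (hK : ∀ x : K, x = 0 ∨ x = 1) (x y : K) : x - y = x + y := by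
  rw [sub_eq_add_neg, neg_eq_iff_add_eq_zero.mpr]
  calc y + y = y * (1 + 1) := by ring
    _ = 0 := by rw [one_add_one_of_two hK, mul_zero]

/-- Coefficients with respect to an independent pair are unique. [folklore] -/
private theorem pair_coeff_eq {V : Type*} [AddCommGroup V] [Module K V] {v w : V}
    (h : LinearIndependent K ![v, w]) {s t s' t' : K} (e : s • v + t • w = s' • v + t' • w) :
    s = s' ∧ t = t' := by
  have h0 : (s - s') • v + (t - t') • w = 0 := by
    rw [sub_smul, sub_smul, ← sub_eq_zero.mpr e]
    abel
  obtain ⟨h₁, h₂⟩ := (LinearIndependent.pair_iff.mp h) _ _ h0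
  exact ⟨sub_eq_zero.mp h₁, sub_eq_zero.mp h₂⟩

/-- The finite heart of KM Cor. 10: over a field with two elements, writing
`B⁽³⁾ = α₃B⁽¹⁾ + β₃B⁽²⁾`, `Γ⁽³⁾ = γ₃Γ⁽¹⁾ + δ₃Γ⁽²⁾`, `B⁽⁴⁾ = α₄B⁽¹⁾ + β₄B⁽²⁾`,
`Γ⁽⁴⁾ = γ₄Γ⁽¹⁾ + δ₄Γ⁽²⁾`, the matrix identity `B⁽¹⁾⊗Γ⁽¹⁾ + B⁽²⁾⊗Γ⁽²⁾ = B⁽³⁾⊗Γ⁽³⁾ + B⁽⁴⁾⊗Γ⁽⁴⁾`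
(four coefficient equations) has exactly six solutions: the two trivial ones and the two flips in
either order ("Because of `K = ℤ₂`, this can only be if `B⁽³⁾ = B⁽¹⁾ + B⁽²⁾` or
`Γ⁽³⁾ = Γ⁽¹⁾ + Γ⁽²⁾` and likewise for `B⁽⁴⁾` and `Γ⁽⁴⁾`", KM, proof of Cor. 10); checked by
exhausting the `2⁸` cases. [folklore] -/
private theorem pencil_solutions_of_two (hK : ∀ x : K, x = 0 ∨ x = 1)
    (α₃ β₃ γ₃ δ₃ α₄ β₄ γ₄ δ₄ : K)
    (e₁ : α₃ * γ₃ + α₄ * γ₄ = 1) (e₂ : α₃ * δ₃ + α₄ * δ₄ = 0) (e₃ : β₃ * γ₃ + β₄ * γ₄ = 0)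
    (e₄ : β₃ * δ₃ + β₄ * δ₄ = 1) :
    (α₃ = 1 ∧ β₃ = 0 ∧ γ₃ = 1 ∧ δ₃ = 0 ∧ α₄ = 0 ∧ β₄ = 1 ∧ γ₄ = 0 ∧ δ₄ = 1) ∨
      (α₃ = 0 ∧ β₃ = 1 ∧ γ₃ = 0 ∧ δ₃ = 1 ∧ α₄ = 1 ∧ β₄ = 0 ∧ γ₄ = 1 ∧ δ₄ = 0) ∨
      (α₃ = 1 ∧ β₃ = 1 ∧ γ₃ = 1 ∧ δ₃ = 0 ∧ α₄ = 0 ∧ β₄ = 1 ∧ γ₄ = 1 ∧ δ₄ = 1) ∨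
      (α₃ = 0 ∧ β₃ = 1 ∧ γ₃ = 1 ∧ δ₃ = 1 ∧ α₄ = 1 ∧ β₄ = 1 ∧ γ₄ = 1 ∧ δ₄ = 0) ∨
      (α₃ = 1 ∧ β₃ = 0 ∧ γ₃ = 1 ∧ δ₃ = 1 ∧ α₄ = 1 ∧ β₄ = 1 ∧ γ₄ = 0 ∧ δ₄ = 1) ∨
      (α₃ = 1 ∧ β₃ = 1 ∧ γ₃ = 0 ∧ δ₃ = 1 ∧ α₄ = 1 ∧ β₄ = 0 ∧ γ₄ = 1 ∧ δ₄ = 1) := by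
  have h11 : (1 : K) + 1 = 0 := one_add_one_of_two hK
  have h10 : (1 : K) ≠ 0 := one_ne_zero
  rcases hK α₃ with rfl | rfl <;> rcases hK β₃ with rfl | rfl <;> rcases hK γ₃ with rfl | rfl <;>
    rcases hK δ₃ with rfl | rfl <;> rcases hK α₄ with rfl | rfl <;> rcases hK β₄ with rfl | rfl <;>
    rcases hK γ₄ with rfl | rfl <;> rcases hK δ₄ with rfl | rfl <;>
    simp only [mul_one, mul_zero, add_zero, zero_add, h11] at e₁ e₂ e₃ e₄ <;>
    first
    | exact absurd e₁ h10.symm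
    | exact absurd e₂ h10
    | exact absurd e₃ h10
    | exact absurd e₄ h10.symm
    | simp [h10, h10.symm]

/-- **Kauers–Moosbauer 2023, Cor. 10 (tensor form; the two replaced elements).** Over a field with
two elements (`K = ℤ₂`), let `a₁⊗b₁⊗c₁ + a₂⊗b₂⊗c₂ = a₃⊗b₃⊗c₃ + a₄⊗b₄⊗c₄` with `aᵢ ≠ 0`,
`b₃, c₃ ≠ 0`, `b₁,b₂` and `c₁,c₂` independent (the situation of Thm. 7, reached in the proof of
Cor. 10 after "say `dim⟨B⁽¹⁾,B⁽²⁾⟩ = dim⟨Γ⁽¹⁾,Γ⁽²⁾⟩ = 2`") and `{T₁,T₂} ≠ {T₃,T₄}`. Then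
`A⁽¹⁾ = A⁽²⁾ = A⁽³⁾ = A⁽⁴⁾` ("therefore we also have `A⁽¹⁾ = A⁽²⁾ = A⁽³⁾ = A⁽⁴⁾`") and
`{T₃, T₄} = {T₁ + T, T₂ − T}` for some `T ∈ {A⊗B⊗Γ', A⊗B'⊗Γ}` — i.e. `{T₃,T₄}` arises from
`{T₁,T₂}` by a FLIP in the sense of Def. 4 ("Thus, `S'` is a flip of `S`"). The scheme-level
wrapper (irreducible schemes `S, S'` of equal rank differing in exactly two elements, whose
irreducibility supplies the two independence hypotheses) is not formalised; this is its content for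
the two exchanged elements. [cite: KauersMoosbauer2022FlipGraphs, Cor. 10] -/
theorem kauersMoosbauer2023_cor10 (hK : ∀ x : K, x = 0 ∨ x = 1) (a₁ a₂ a₃ a₄ : ι → K)
    (b₁ b₂ b₃ b₄ : κ → K) (c₁ c₂ c₃ c₄ : μ → K) (ha₁ : a₁ ≠ 0) (ha₂ : a₂ ≠ 0) (ha₃ : a₃ ≠ 0)
    (ha₄ : a₄ ≠ 0) (hb₃ : b₃ ≠ 0) (hc₃ : c₃ ≠ 0)
    (hb : LinearIndependent K ![b₁, b₂]) (hc : LinearIndependent K ![c₁, c₂])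
    (hsum : triad a₁ b₁ c₁ + triad a₂ b₂ c₂ = triad a₃ b₃ c₃ + triad a₄ b₄ c₄)
    (hne : ({triad a₁ b₁ c₁, triad a₂ b₂ c₂} : Set (ι → κ → μ → K)) ≠
      {triad a₃ b₃ c₃, triad a₄ b₄ c₄}) :
    (a₂ = a₁ ∧ a₃ = a₁ ∧ a₄ = a₁) ∧
      ∃ T ∈ ({triad a₁ b₁ c₂, triad a₁ b₂ c₁} : Set (ι → κ → μ → K)),
        ({triad a₃ b₃ c₃, triad a₄ b₄ c₄} : Set (ι → κ → μ → K)) =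
          {triad a₁ b₁ c₁ + T, triad a₂ b₂ c₂ - T} := by
  obtain ⟨h1, h2, h3⟩ :=
    kauersMoosbauer2023_thm7 a₁ a₂ a₃ a₄ b₁ b₂ b₃ b₄ c₁ c₂ c₃ c₄ ha₁ ha₂ ha₃ ha₄ hb₃ hc₃ hb hc
      hsum hne
  -- (1) over `ℤ₂` a line has one non-zero point: all `aᵢ` are equal.
  have hline : ∀ v ∈ ({a₁, a₂, a₃, a₄} : Set (ι → K)), v ≠ 0 → v = a₁ := by
    intro v hv hv0
    set V := Submodule.span K ({a₁, a₂, a₃, a₄} : Set (ι → K))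
    have ha₁V : a₁ ∈ V := Submodule.subset_span (by simp)
    have hvV : v ∈ V := Submodule.subset_span hv
    have hne0 : (⟨a₁, ha₁V⟩ : V) ≠ 0 := fun h0 => ha₁ (by simpa using congrArg Subtype.val h0)
    obtain ⟨c, hc'⟩ := (finrank_eq_one_iff_of_nonzero' _ hne0).mp h1 ⟨v, hvV⟩
    have hcv : c • a₁ = v := by simpa using congrArg Subtype.val hc'
    have hc0 : c ≠ 0 := by
      rintro rfl
      exact hv0 (by rw [← hcv, zero_smul])
    rw [← hcv, (hK c).resolve_left hc0, one_smul]
  have e₂ : a₂ = a₁ := hline a₂ (by simp) ha₂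
  have e₃ : a₃ = a₁ := hline a₃ (by simp) ha₃
  have e₄ : a₄ = a₁ := hline a₄ (by simp) ha₄
  refine ⟨⟨e₂, e₃, e₄⟩, ?_⟩
  obtain ⟨e₂', e₃', e₄'⟩ : a₁ = a₂ ∧ a₁ = a₃ ∧ a₁ = a₄ := ⟨e₂.symm, e₃.symm, e₄.symm⟩
  subst e₂' e₃' e₄'
  -- (2), (3): coordinates of `b₃, b₄, c₃, c₄` in the bases `b₁, b₂` and `c₁, c₂`.
  have hb₃m : b₃ ∈ Submodule.span K ({b₁, b₂} : Set (κ → K)) := by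
    rw [h2]; exact Submodule.subset_span (by simp)
  have hb₄m : b₄ ∈ Submodule.span K ({b₁, b₂} : Set (κ → K)) := by
    rw [h2]; exact Submodule.subset_span (by simp)
  have hc₃m : c₃ ∈ Submodule.span K ({c₁, c₂} : Set (μ → K)) := by
    rw [h3]; exact Submodule.subset_span (by simp)
  have hc₄m : c₄ ∈ Submodule.span K ({c₁, c₂} : Set (μ → K)) := by
    rw [h3]; exact Submodule.subset_span (by simp)
  obtain ⟨α₃, β₃, hb₃e⟩ := Submodule.mem_span_pair.mp hb₃m
  obtain ⟨α₄, β₄, hb₄e⟩ := Submodule.mem_span_pair.mp hb₄m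
  obtain ⟨γ₃, δ₃, hc₃e⟩ := Submodule.mem_span_pair.mp hc₃m
  obtain ⟨γ₄, δ₄, hc₄e⟩ := Submodule.mem_span_pair.mp hc₄m
  -- dual functionals and the matrix identity `b₁⊗c₁ + b₂⊗c₂ = b₃⊗c₃ + b₄⊗c₄`
  obtain ⟨ψ₁, hψ₁1, hψ₁2⟩ := exists_dual_pair hb
  obtain ⟨ψ₂, hψ₂1, hψ₂2⟩ := exists_dual_pair' hb
  obtain ⟨θ, hθ⟩ := Module.Projective.exists_dual_eq_one K ha₁
  have N : (1 : K) • (fun y z => b₁ y * c₁ z) + (1 : K) • (fun y z => b₂ y * c₂ z) =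
      (1 : K) • (fun y z => b₃ y * c₃ z) + (1 : K) • (fun y z => b₄ y * c₄ z) := by
    have e := congrArg (fun t : ι → κ → μ → K => fun y z => θ (fun x => t x y z)) hsum
    simp only [contract₁_pair, hθ] at e
    exact e
  have hψ₁3 : ψ₁ b₃ = α₃ := by
    rw [← hb₃e, map_add, map_smul, map_smul, hψ₁1, hψ₁2, smul_eq_mul, smul_eq_mul]; ring
  have hψ₁4 : ψ₁ b₄ = α₄ := by
    rw [← hb₄e, map_add, map_smul, map_smul, hψ₁1, hψ₁2, smul_eq_mul, smul_eq_mul]; ring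
  have hψ₂3 : ψ₂ b₃ = β₃ := by
    rw [← hb₃e, map_add, map_smul, map_smul, hψ₂1, hψ₂2, smul_eq_mul, smul_eq_mul]; ring
  have hψ₂4 : ψ₂ b₄ = β₄ := by
    rw [← hb₄e, map_add, map_smul, map_smul, hψ₂1, hψ₂2, smul_eq_mul, smul_eq_mul]; ring
  -- the four coefficient equations
  have E₁ := congrArg (fun M : κ → μ → K => fun z => ψ₁ (fun y => M y z)) N
  have E₂ := congrArg (fun M : κ → μ → K => fun z => ψ₂ (fun y => M y z)) N
  simp only [contractκ_pencil] at E₁ E₂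
  simp only [one_mul, hψ₁1, hψ₁2, hψ₁3, hψ₁4, hψ₂1, hψ₂2, hψ₂3, hψ₂4, one_smul, zero_smul,
    add_zero, zero_add] at E₁ E₂
  -- `E₁ : c₁ = α₃ • c₃ + α₄ • c₄`, `E₂ : c₂ = β₃ • c₃ + β₄ • c₄`
  rw [← hc₃e, ← hc₄e] at E₁ E₂
  have F₁ : (1 : K) • c₁ + (0 : K) • c₂ =
      (α₃ * γ₃ + α₄ * γ₄) • c₁ + (α₃ * δ₃ + α₄ * δ₄) • c₂ := by
    rw [one_smul, zero_smul, add_zero]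
    exact E₁.trans (by module)
  have F₂ : (0 : K) • c₁ + (1 : K) • c₂ =
      (β₃ * γ₃ + β₄ * γ₄) • c₁ + (β₃ * δ₃ + β₄ * δ₄) • c₂ := by
    rw [one_smul, zero_smul, zero_add]
    exact E₂.trans (by module)
  obtain ⟨q₁₁, q₁₂⟩ := pair_coeff_eq hc F₁
  obtain ⟨q₂₁, q₂₂⟩ := pair_coeff_eq hc F₂
  -- the pointwise identities recognising the flips (`−` is `+` when `1 + 1 = 0`)
  have hsub := sub_eq_add_of_two hK
  have flipB : ∀ (b b' : κ → K) (c : μ → K),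
      triad a₁ (b + b') c = triad a₁ b c + triad a₁ b' c := fun b b' c => by
    funext x y z; simp only [Pi.add_apply, triad_apply]; ring
  have flipC : ∀ (b : κ → K) (c c' : μ → K),
      triad a₁ b (c + c') = triad a₁ b c' - triad a₁ b c := fun b c c' => by
    funext x y z; simp only [Pi.add_apply, Pi.sub_apply, triad_apply, hsub]; ring
  have flipB' : ∀ (b b' : κ → K) (c : μ → K),
      triad a₁ (b + b') c = triad a₁ b' c - triad a₁ b c := fun b b' c => by
    funext x y z; simp only [Pi.add_apply, Pi.sub_apply, triad_apply, hsub]; ring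
  have flipC' : ∀ (b : κ → K) (c c' : μ → K),
      triad a₁ b (c + c') = triad a₁ b c + triad a₁ b c' := fun b c c' => by
    funext x y z; simp only [Pi.add_apply, triad_apply]; ring
  rcases pencil_solutions_of_two hK α₃ β₃ γ₃ δ₃ α₄ β₄ γ₄ δ₄ q₁₁.symm q₁₂.symm q₂₁.symm q₂₂.symm
    with ⟨rfl, rfl, rfl, rfl, rfl, rfl, rfl, rfl⟩ | ⟨rfl, rfl, rfl, rfl, rfl, rfl, rfl, rfl⟩ |
    ⟨rfl, rfl, rfl, rfl, rfl, rfl, rfl, rfl⟩ | ⟨rfl, rfl, rfl, rfl, rfl, rfl, rfl, rfl⟩ |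
    ⟨rfl, rfl, rfl, rfl, rfl, rfl, rfl, rfl⟩ | ⟨rfl, rfl, rfl, rfl, rfl, rfl, rfl, rfl⟩
  all_goals
    simp only [one_smul, zero_smul, add_zero, zero_add] at hb₃e hb₄e hc₃e hc₄e
    subst hb₃e hb₄e hc₃e hc₄e
  · -- `T₃ = T₁`, `T₄ = T₂`: excluded
    exact (hne rfl).elim
  · -- `T₃ = T₂`, `T₄ = T₁`: excluded
    exact (hne (Set.pair_comm _ _)).elim
  · -- `T₃ = A⊗(B+B')⊗Γ = T₁ + T`, `T₄ = A⊗B'⊗(Γ+Γ') = T₂ − T`, with `T = A⊗B'⊗Γ`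
    exact ⟨triad a₁ b₂ c₁, by simp, by rw [flipB, flipC]⟩
  · -- the same flip, listed in the other order
    exact ⟨triad a₁ b₂ c₁, by simp, by rw [flipB, flipC, Set.pair_comm]⟩
  · -- `T₃ = A⊗B⊗(Γ+Γ') = T₁ + T`, `T₄ = A⊗(B+B')⊗Γ' = T₂ − T`, with `T = A⊗B⊗Γ'`
    exact ⟨triad a₁ b₁ c₂, by simp, by rw [flipC', flipB']⟩
  · exact ⟨triad a₁ b₁ c₂, by simp, by rw [flipC', flipB', Set.pair_comm]⟩

end TwoElements

end FlipGraph

end Literature.Computability.AlgebraicComplexity
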